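import Summits.CriticalPhenomena.Ising3DConformalLimit.Theorems.PerfectScreeningCoulombImpliesNontrivialOfIsingCapacity
import Summits.CriticalPhenomena.Ising3DConformalLimit.Theorems.PerfectScreeningCoulombImpliesNontrivialEssentialityCriterion
import Summits.CriticalPhenomena.Ising3DConformalLimit.Theorems.PerfectScreeningCoulombImpliesNontrivialEssentialityIdentity
import Summits.CriticalPhenomena.Ising3DConformalLimit.Theorems.PerfectScreeningCoulombImpliesNontrivialContactLowerBound
import Summits.CriticalPhenomena.Ising3DConformalLimit.Theorems.PerfectScreeningCoulombImpliesNontrivialThinFatLaw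
import Literature.Probability.LatticeModels.CurrentsPartialMonotonicity
import Literature.Probability.LatticeModels.SharpnessProofs
import Literature.Probability.LatticeModels.TwoCurrentClusterCalculus
import HarnessLib

/-!
# Line `merging-is-expected-screening` for crux `CoulombImpliesNontrivial` (stmt-CriticalPhenomena-13885)
# — LEAD SKELETON v3.3 (lead c6, 2026-08-17: side stubs W1–W3 LANDED p144714/p144713/p144791; ONE open stub S_B; v2.1 by lead a1, v3.1 by lead c5): v2.1's ONE open stub reshaped into
# S_A `stub_essentialityCriterion` (LANDED p141675) + S_B `stub_spreadDefectsEssential` (open heart); assembly LANDED (p124053)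

Crux (route PerfectScreening, r3), verbatim the route decl
`Summit.CriticalPhenomena.Ising3DConformalLimit.Theses.PerfectScreening.CoulombImpliesNontrivial`:
`(∃ c > 0, ∀ x ≠ 0, c/‖x‖ ≤ criticalTwoPoint 3 x) → ∀ ρ S, (ρ > 0 on (0,1]) →
  HasPointwiseScalingLimit (criticalCorr 3) ρ S → IsNondegenerateTwoPoint S → HasNontrivialU4 S`.

## What changed against the planner's checked skeleton (v1, 3 stubs S1 S2 S3; kept as `Lines/…` history)

The planner's line (idea `merging-is-expected-screening`: merging probability = expected relative screening of the
partner pair by the sourced⊗sourceless double cluster, ADC21 Lemma A.1; S1 merge-from-screening, S2 certified double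
cluster under Coulomb, S3 capacity screening) is, mechanism for mechanism, the line `karamata-amplitude-blind-merging`
of the sister crux stmt-CriticalPhenomena-13886 (`GaussianLimitNotScreened`, same route, r4), whose lead has
ALREADY LANDED every provable piece under `Theorems/PerfectScreeningGaussianLimitNotScreened*.lean`:
* S1 ≡ `stub_depletionBound` (p89777; ADC21 Lemma A.1 as an equality, box form, `defectG`/`traceCluster` vocabulary)
  — and the lead found v1's S1 FALSE as registered in the corner `β = 0`, `x = y`, `z ≠ t` (junk zero measure on the
  sourced side; reshaped to `0 < β` in v1.1, now moot);
* S2 ⊂ `stub_clusterMomentsBox` (p99612, PZ ∧ Markov in the box) + `stub_oneArmAsymptotics` (p93865) +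
  `stub_dyadicShellSums` (p86861) ⟹ `stub_fatSpreadCluster` (p102368): for a non-degenerate limit, scale covariant with
  exponent `Δ`, and every `0 < s < 3 − 2Δ`, the double cluster of `x̃₀` contains w.p. `≥ c` a SPREAD `s`-DIMENSIONAL
  DEFECT (`IsSpreadDefect s K λ ν`: in the `KR`-ball, mass `≥ νRˢ`, Riesz `s`-energy `≤ λR^{-s}#C²`) avoiding `x̃₂,x̃₃`;
* the Coulomb antecedent enters ONLY through the landed `CoulombImpliesNontrivialNegative.canonical_of_coulomb`
  (Negative/Antecedent.lean, the crux's disprover): under `c/‖x‖ ≤ G` every non-degenerate pointwise limit is scale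
  covariant with `Δ = 1/2`, so `3 − 2Δ = 2` and EVERY `s < 2` is available (amplitude-blind engine: no `Z`, no `ρ`).
Hence v1's S1 and S2 are DISCHARGED by imports, and the crux reduces — kernel-checked and LANDED as
`Theorems/PerfectScreeningCoulombImpliesNontrivialOfIsingCapacity.lean` (p124053: registered bookkeeping stub
`stub_cruxOfIsingCapacityAxial`, engine `twoCurrentMeet_lower_of_capacityAt`, corollary
`coulombImpliesNontrivial_of_isingCapacity` = 13886's stub verbatim ⟹ this crux) — to ONE deterministic statement about the critical nearest-neighbour
Ising₃ model, `stub_isingCapacityAxial`: an EXISTENTIAL-in-`s` (any one `s ∈ (0,2)`), AXIAL-pairs weakening of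
13886's registered `stub_isingCapacity` (`∀ s > 3/2`, all pairs). Any proof of their stub proves ours
(`isingCapacityAxial_of_isingCapacity`, 3 lines); ours may be provable at a single convenient exponent.
v1's S3 (`stub_capacityScreening`: certificate = mass `≥ c₁R²` AND Newtonian energy `≤ C₁R³` in the middle ball,
axial pairs; vocabulary landed as `Theorems/PerfectScreeningCoulombImpliesNontrivialScreeningDefs.lean`, p123561) is
the `s = 2` cousin; it stays the documented FALLBACK should spread `s`-defects with `s < 2` turn out not to screen
while `s = 2` certified sets do (then v1's S2 — mass `R²` under Coulomb, not reachable amplitude-blind — is needed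
again and is provable from `stub_clusterMomentsBox` + Coulomb box-sum asymptotics).

## The composition (landed p124053; here `CoulombImpliesNontrivial_of` = assembly applied to the stub, crux BY NAME)

Coulomb ⟹ `ScaleCovariantOn (1/2) S` (canonical_of_coulomb) ⟹ at the collinear axial quadruple
`x = (0, e₀, 2e₀, 3e₀)` and the stub's exponent `s < 2`: fat spread cluster w.p. `≥ c` (stub_fatSpreadCluster) ⟹ with
the stub (pairs `[2e₀/δ], [3e₀/δ]` are axial, eventually `R₀`-separated) + Griffiths (`defectG_anti`) every cluster
containing such a defect depletes `⟨σ_{x̃₂}σ_{x̃₃}⟩` by `1 − c'` ⟹ `P² ≥ c'c` (stub_depletionBound) ⟹ `HasNontrivialU4 S`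
(hasNontrivialU4_of_twoCurrentMeet_lower, Aizenman's criterion, landed under crux 0636).

HARDEST (only) STUB: `stub_isingCapacityAxial` — held by the lead. WHY OPEN (both leads agree): every printed
inequality bounds depletion from the wrong side (Griffiths `c' ≥ 0`; backbone-weight monotonicity
`depletion ≤ P^{ce}[backbone hits C]`; Simon–Lieb loses `R^{1-η}`); physics: a free defect couples to `ε`, relevant
iff `s > Δ_ε(3) ≈ 1.4126`, so the statement is believed TRUE for every `s ∈ (1.42, 2)` and FALSE below (lines,
dilute dusts) — the existential form lets the prover sit at `s` close to `2`.

DISPROOF USED (`Cruxes/CoulombImpliesNontrivial/Disproof.lean`, re-read 2026-08-16T19:5xZ): `crux_iff`, §7(i) (target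
is 0636's `P² ≥ κ`), `not_twoPointOnly`/`not_latticeShadow` (honoured: switching in stub_depletionBound, `ε`-coupling
in the stub), §5/Negative/DimensionFive (d-specificity: the fat cluster needs `s < 3 − 2Δ` with `Δ = (d-2)/2`, i.e.
`s < 2` only in `d = 3`; in `d ≥ 5` relevant defects `s > Δ_ε = d - 2 ≥ 3` do not fit in a cluster of dimension
`4 - d < 0`… the certificate event has probability → 0), §4 (canonical_of_coulomb IS the §4.1 theorem), §8(b) (no
single currents). Sister disproof `Cruxes/GaussianLimitNotScreened/Disproof.lean` v4 + TRIAGE-r1-2/3 (counterexamples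
to NAIVE capacity: ∃c-vacuity, dilute dusts `N ≍ R^{1.04}`, lines, clumps) are excluded by `IsSpreadDefect` with
`s` near 2 exactly as in 13886's typing.
-/

noncomputable section

namespace Summit.CriticalPhenomena.Ising3DConformalLimit.Cruxes.CoulombImpliesNontrivial.MergingIsExpectedScreening

open Filter Topology Set MeasureTheory Finset
open Literature.Probability.LatticeModels Literature.Probability.Percolation
open Summit.CriticalPhenomena.Ising3DConformalLimit.Cruxes.IsingEuclidUpgradeR4NonGaussian.FreeCovarianceDeltaDichotomy
  (lat boxG threePointRatio twoCurrentMeet)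
open Summit.CriticalPhenomena.Ising3DConformalLimit.Cruxes.GaussianLimitNotScreened.KaramataAmplitudeBlindMerging
  (IsSpreadDefect defectG)
open scoped symmDiff

/-! ## v3 (lead c5, 2026-08-17): the one open stub RESHAPED through the nested switching lemma

ESSENTIALITY DICTIONARY (ADS15 Lemma 2.2 = tree `Current.etsum_switching_univ`, with the sourceless current living on the
depleted graph `Λ_L ∖ E(C)` and the sourced one on `Λ_L`):
`⟨σ_cσ_e⟩_{Λ_L∖C} / ⟨σ_cσ_e⟩_{Λ_L} = P^{∅}_{Λ_L∖C} ⊗ P^{ce}_{Λ_L}[c ↔ e through bonds OFF C]`, hence the depletion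
`1 − ⟨σσ⟩_{Λ∖C}/⟨σσ⟩_Λ` is EXACTLY the probability that `C` is ESSENTIAL for the `c–e` connection of (one sourced current on
the full box) + (independent sourceless loops on the depleted box). So `stub_isingCapacityAxial` ⟸ (S_A) the criterion
(provable now, M) + (S_B) "spread defects are essential" (the open heart in current language, XL). Un-normalised current sums
on `freeBoxGraph 3 L`, coupling `K ≡ β_c(3)`, defect vertices `boxSources 3 L C`, sources `boxSources 3 L ({c}∆{e})`:
* `Z_{off}[∅] := ecurrentSumIn (offGraph (freeBoxGraph 3 L) (boxSources 3 L C)) K ∅`,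
* `Z[ce]     := ecurrentSum K (boxSources 3 L ({c} ∆ {e}))`,
* `DISC      := ∑_p 𝟙[p.1 ⊆ E(off C), ∂p.1 = ∅] w(p.1) 𝟙[∂p.2 = {c}∆{e}] w(p.2) 𝟙[c ↮ e through (p.1+p.2) restricted to E(off C)]`
  (the connection read on the lifted trace: `liftBonds 3 L ((p.1+p.2).tracedIn (offGraph …)) ∉ openConn c e`).
-/

/-! S_A `stub_essentialityCriterion` — LANDED p141675 (wave 1, 2026-08-17T04:3xZ) as
`Theorems/PerfectScreeningCoulombImpliesNontrivialEssentialityCriterion.lean` (imported; same FQN, used below by name).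
Reusable helpers landed with it: `defectG_le_of_disconnection` (box-vertex form, hypothesis with `(Current.connIn G₁ c₀ e₀)ᶜ.indicator`),
`defectG_map_boxSources`, `indicator_liftBonds_notMem_openConn`. -/

/-- **STUB `stub_spreadDefectsEssential` (S_B; XL — THE OPEN HEART in current language, equivalent to v2.1's
`stub_isingCapacityAxial` by the essentiality dictionary).** There is ONE exponent `s ∈ (0,2)` such that for all
`K, λ, ν > 0` there are `c' ∈ (0,1]`, `R₀` with: for every AXIAL pair `(c,e)`, `‖c − e‖ ≥ R₀`, all large `L`, and every
spread `s`-dimensional defect `C` avoiding `c, e` (`IsSpreadDefect s K λ ν c e C`), the defect is ESSENTIAL with probability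
`≥ c'`: under (sourceless current on `Λ_L ∖ E(C)`) ⊗ (current on `Λ_L` with sources `c, e`), independent, the event
"`c ↮ e` through bonds off `C`" has mass `≥ c'·Z_{off}[∅]·Z[ce]`. Where thinness helps: the sourced SINGLE current is thin
(D ≈ 1.75, Disproof §8) and the helper lives off `C`; every bound needed is an UPPER bound on an off-`C` connection.
Believed TRUE for `s ∈ (Δ_ε, 2)`, `Δ_ε(3) ≈ 1.41` (same MC as the capacity form: depletion = essentiality exactly).
[cite: AizenmanDuminilCopinAnnals2021, App. A Lemma A.1 and Remark A.5] [cite: PolandRychkovVichi2019, §II (Δ_ε = 1.412625)] -/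
theorem stub_spreadDefectsEssential :
    ∃ s : ℝ, 0 < s ∧ s < 2 ∧ ∀ K lam nu : ℝ, 0 < K → 0 < lam → 0 < nu →
      ∃ c' : ℝ, 0 < c' ∧ c' ≤ 1 ∧ ∃ R₀ : ℝ, ∀ c e : Site 3, (∀ j : Fin 3, j ≠ 0 → e j = c j) →
        R₀ ≤ ‖c - e‖ → ∀ᶠ L : ℕ in atTop, ∀ C : Finset (Site 3), c ∉ C → e ∉ C →
          IsSpreadDefect s K lam nu c e C →
          ENNReal.ofReal c' *
              ecurrentSumIn (offGraph (freeBoxGraph 3 L) (boxSources 3 L C))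
                (fun _ : (freeBoxGraph 3 L).edgeFinset => criticalBeta 3) ∅ *
              ecurrentSum (fun _ : (freeBoxGraph 3 L).edgeFinset => criticalBeta 3)
                (boxSources 3 L ({c} ∆ {e})) ≤
            ∑' p : Current (freeBoxGraph 3 L) × Current (freeBoxGraph 3 L),
              (if Current.IsSupp (offGraph (freeBoxGraph 3 L) (boxSources 3 L C)) p.1 ∧ p.1.sources = ∅
                then p.1.eweight (fun _ : (freeBoxGraph 3 L).edgeFinset => criticalBeta 3) else 0) *
              (if p.2.sources = boxSources 3 L ({c} ∆ {e})
                then p.2.eweight (fun _ : (freeBoxGraph 3 L).edgeFinset => criticalBeta 3) else 0) *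
              {q : Current (freeBoxGraph 3 L) × Current (freeBoxGraph 3 L) |
                  liftBonds 3 L ((q.1 + q.2).tracedIn (offGraph (freeBoxGraph 3 L) (boxSources 3 L C))) ∉
                    openConn c e}.indicator 1 p := by
  sorry

/-! ## v2.1's stub, now DERIVED (kept verbatim: it is what the landed assembly p124053 consumes) -/

/-- **`stub_isingCapacityAxial` (v2.1's registered open stub) from S_A + S_B**: essentiality of spread defects
(S_B) fed through the essentiality criterion (S_A) at every large `L` (`c, e ∈ Λ_L` eventually). [cite: AizenmanDuminilCopinAnnals2021, App. A Lemma A.1 and Remark A.5] -/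
theorem stub_isingCapacityAxial :
    ∃ s : ℝ, 0 < s ∧ s < 2 ∧ ∀ K lam nu : ℝ, 0 < K → 0 < lam → 0 < nu →
      ∃ c' : ℝ, 0 < c' ∧ c' ≤ 1 ∧ ∃ R₀ : ℝ, ∀ c e : Site 3, (∀ j : Fin 3, j ≠ 0 → e j = c j) →
        R₀ ≤ ‖c - e‖ → ∀ᶠ L : ℕ in atTop, ∀ C : Finset (Site 3), c ∉ C → e ∉ C →
          IsSpreadDefect s K lam nu c e C → defectG L C c e ≤ (1 - c') * boxG L c e := by
  obtain ⟨s, hs₀, hs₂, h⟩ := stub_spreadDefectsEssential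
  refine ⟨s, hs₀, hs₂, fun K lam nu hK hlam hnu => ?_⟩
  obtain ⟨c', hc', hc'1, R₀, hR⟩ := h K lam nu hK hlam hnu
  refine ⟨c', hc', hc'1, R₀, fun c e hax hce => ?_⟩
  filter_upwards [hR c e hax hce, eventually_mem_box c, eventually_mem_box e] with L hL hcL heL
  intro C hcC heC hspread
  exact stub_essentialityCriterion L C c e hcL heL hcC heC c' hc'.le (hL C hcC heC hspread)


/-! ## Side stubs — ALL LANDED (wave 1 of lead c6, 2026-08-17T06:2xZ; imported above, same FQNs)
* `stub_essentialityIdentity` — p144714, `Theorems/PerfectScreeningCoulombImpliesNontrivialEssentialityIdentity.lean`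
  (+ helpers `tsum_isSupp_empty_pair_connIn_eq`, `indicator_liftBonds_mem_openConn`, `defectG_mul_eq_boxG_mul_connection`);
* `stub_contactLowerBound` — p144713, `Theorems/PerfectScreeningCoulombImpliesNontrivialContactLowerBound.lean`
  (+ helper `setOf_mem_traceCluster_eq`);
* `stub_thinFatLaw` — p144791, `Theorems/PerfectScreeningCoulombImpliesNontrivialThinFatLaw.lean`
  (+ helpers `splice_phi`, `thin_step`, `fat_step`).
The three are available below by name; they are structural (not in the cone of `CoulombImpliesNontrivial_of`). -/

/-! ## The skeleton theorem -/

/-- **THE LINE CONCLUDES THE CRUX BY NAME** (no hypotheses; the one registered stub consumed by name through the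
LANDED conditional assembly `stub_cruxOfIsingCapacityAxial`, p124053). [cite: Aizenman1982, §1] -/
theorem CoulombImpliesNontrivial_of :
    Summit.CriticalPhenomena.Ising3DConformalLimit.Theses.PerfectScreening.CoulombImpliesNontrivial :=
  stub_cruxOfIsingCapacityAxial stub_isingCapacityAxial

end Summit.CriticalPhenomena.Ising3DConformalLimit.Cruxes.CoulombImpliesNontrivial.MergingIsExpectedScreening

end
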